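import Summits.HodgeConjecture.HodgeConjecture.Theorems.LinearSystemTorelliLocalTubeSpanAbelianTail
import Summits.HodgeConjecture.HodgeConjecture.Theorems.LinearSystemTorelliLocalTubeSpanFramePartialSpan

/-!
# Route LinearSystemTorelli — crux `LocalTubeSpan`: mixed points (cluster + nodes)

Helper file (`--supports stmt-HodgeConjecture-2490`, line `Sketch`, composition
`injective_evalCoinv_of_mixed` of the lead's skeleton).  The local Schnell theorem at a MIXED point
of the discriminant — one Janssen-complete cluster of local vanishing cycles (meridians `s₁`) plus
transversal nodes (meridians `s₂`) whose cycles are non-zero, orthogonal to everything and tied to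
the cluster by relations (e.g. the tacnode + node member `C₁ ∪ C₂`, `δ₁ + δ₃ + δ₄ = 0`, detecting
word `T₁²T₃⁻¹T₄²`): Schnell's third map `H¹(G, V) → ∏_g V/(g - 1)V` is injective, given

* on the cluster: a linearly independent transvection frame inside `⟨s₁⟩` in which every `t ∈ s₁`
  has a positive power up to elements acting trivially on `L₁ = ℚe(s₁)` (Schnell's Lemma 11 /
  Janssen Thm. 2.5 for the complete orbit), and no cluster cycle in the radical of `L₁`;
* on the glue: Janssen companions `a, a + cℓ` (transvections in `⟨s₁⟩`) for every non-zero
  `ℓ ∈ L₁ ∩ ℚe(s₂)` (Janssen Thm. 2.9).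

* `localTubeSpan_injective_evalCoinv_of_mixed` — the partial frame theorem on the span of the cluster
  (`…FramePartialSpan`) kills an undetected cocycle on `s₁` up to a coboundary; the abelian tail
  (`…AbelianTail`) shows the rest is a coboundary.

Reference: C. Schnell, *Primitive cohomology and the tube mapping*, Math. Z. 268 (2010) §7;
W. Janssen, Math. Ann. 266 (1983) Thms. 2.5, 2.9.  No named facts (both Janssen inputs are
hypotheses here).
-/

-- `Summit.HodgeConjecture.HodgeConjecture.Theorems` is the mandated namespace (single-conjunct summit:
-- Sub = Summit), which `linter.dupNamespace` flags on every declaration; the lakefile turns the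
-- linter off tree-wide (weak option), restated here so stand-alone elaboration is warning-free too.
set_option linter.dupNamespace false

noncomputable section

open CategoryTheory groupCohomology
open Literature.AlgebraicGeometry.HodgeTheory

namespace Summit.HodgeConjecture.HodgeConjecture.Theorems

section Mixed

variable {G : Type} [Group G] (A : Rep.{0} ℚ G)

/-- **The local Schnell theorem at a mixed point** (cluster + transversal nodes; see the module
docstring for the hypotheses).  Schnell's third map `H¹(G, V) → ∏_{g ∈ G} V/(g - 1)V` is
injective. [cite: Schnell2010, §7 Prop. 12 (proof)] -/
theorem localTubeSpan_injective_evalCoinv_of_mixed [FiniteDimensional ℚ A.V]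
    (B : LinearMap.BilinForm ℚ A.V) (hB : B.Nondegenerate) (hBalt : B.IsAlt)
    (s₁ s₂ : Set G) (hs : Subgroup.closure (s₁ ∪ s₂) = ⊤) (e : G → A.V)
    (hPL : ∀ t ∈ s₁ ∪ s₂, ∀ x : A.V, A.ρ t x = x - B x (e t) • e t)
    (horth : ∀ t ∈ s₂, ∀ t' ∈ s₁ ∪ s₂, B (e t) (e t') = 0) (hne : ∀ t ∈ s₂, e t ≠ 0)
    (hnotR : ∀ t ∈ s₁, e t ∉ Submodule.span ℚ (e '' s₁) ⊓ B.orthogonal (Submodule.span ℚ (e '' s₁)))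
    {r : ℕ} (u : Fin r → G) (hu₁ : ∀ i, u i ∈ Subgroup.closure s₁) (δ' : Fin r → A.V)
    (hli : LinearIndependent ℚ δ')
    (hu : ∀ (i : Fin r) (x : A.V), A.ρ (u i) x = x - B x (δ' i) • δ' i)
    (hvirtL : ∀ t ∈ s₁, ∃ m : ℕ, 0 < m ∧ ∃ γ ∈ Subgroup.closure (Set.range u),
      ∀ x ∈ Submodule.span ℚ (e '' s₁), A.ρ (t ^ m) x = A.ρ γ x)
    (hcomp : ∀ ℓ ∈ Submodule.span ℚ (e '' s₁) ⊓ Submodule.span ℚ (e '' s₂), ℓ ≠ 0 →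
      ∃ g₁ ∈ Subgroup.closure s₁, ∃ g₂ ∈ Subgroup.closure s₁, ∃ (a : A.V) (c : ℚ),
        a ≠ 0 ∧ a + c • ℓ ≠ 0 ∧ c ≠ 0 ∧ a ∈ Submodule.span ℚ (e '' s₁) ∧
        (∀ x : A.V, A.ρ g₁ x = x - B x a • a) ∧
        (∀ x : A.V, A.ρ g₂ x = x - B x (a + c • ℓ) • (a + c • ℓ))) :
    Function.Injective (evalCoinv A) := by
  refine (injective_iff_map_eq_zero _).2 fun ξ hξ => ?_
  induction ξ using H1_induction_on with
  | h φ =>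
    have hund : ∀ g : G, (φ : G → A.V) g ∈ subOneRange A g := fun g => by
      have := congr_fun hξ g
      rwa [evalCoinv_H1π, Pi.zero_apply, Submodule.mkQ_apply, Submodule.Quotient.mk_eq_zero]
        at this
    -- orthogonality of the node cycles to `L₁`, in the form the partial frame theorem wants
    have hout : ∀ t ∈ (s₁ ∪ s₂) \ s₁, ∀ y ∈ Submodule.span ℚ (e '' s₁), B y (e t) = 0 := by
      intro t ht y hy
      have ht₂ : t ∈ s₂ := ht.1.resolve_left ht.2
      refine Submodule.span_induction (fun x hx => ?_) (by simp) (fun x y _ _ hx hy => ?_)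
        (fun c x _ hx => ?_) hy
      · obtain ⟨t', ht', rfl⟩ := hx
        rw [← hBalt.neg_eq, horth t ht₂ t' (Or.inl ht'), neg_zero]
      · rw [map_add, LinearMap.add_apply, hx, hy, add_zero]
      · rw [map_smul, LinearMap.smul_apply, hx, smul_zero]
    obtain ⟨v, hv⟩ := localTubeSpan_exists_sub_eq_of_frame_on_span_partial A B hBalt (s₁ ∪ s₂) hs e
      hPL s₁ Set.subset_union_left hnotR hout u hu₁ δ' hli hu hvirtL φ hund
    -- the adjusted cocycle vanishes on `s₁`, is undetected, and differs from `φ` by a coboundary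
    obtain ⟨φ', hφ'apply⟩ : ∃ φ' : cocycles₁ A,
        ∀ g, (φ' : G → A.V) g = (φ : G → A.V) g - (A.ρ g v - v) :=
      ⟨φ - ⟨d₀₁ A v, d₀₁_apply_mem_cocycles₁ v⟩, fun g => by
        change (φ : G → A.V) g - d₀₁ A v g = _
        rw [d₀₁_hom_apply]⟩
    have hund' : ∀ g : G, (φ' : G → A.V) g ∈ subOneRange A g := fun g => by
      obtain ⟨w, hw⟩ := hund g
      refine ⟨w - v, ?_⟩
      rw [hφ'apply, ← hw]
      simp only [LinearMap.sub_apply, LinearMap.id_apply, map_sub]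
    have hzero' : H1π A φ' = 0 :=
      localTubeSpan_H1π_eq_zero_of_abelianTail A B hB hBalt s₁ s₂ hs e hPL horth hne hcomp φ' hund'
        (fun t ht => by rw [hφ'apply, hv t ht, sub_self])
    -- `φ'` is a coboundary `dw`, hence `φ = d(w + v)`
    rw [H1π_eq_zero_iff, mem_coboundaries₁_iff_exists] at hzero' ⊢
    obtain ⟨w, hw⟩ := hzero'
    refine ⟨w + v, fun g => ?_⟩
    have := hw g
    rw [hφ'apply] at this
    calc A.ρ g (w + v) - (w + v) = (A.ρ g w - w) + (A.ρ g v - v) := by rw [map_add]; abel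
      _ = (φ : G → A.V) g := by rw [this]; abel

end Mixed

end Summit.HodgeConjecture.HodgeConjecture.Theorems

end
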